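import Summits.BirchSwinnertonDyer.Rank1Residual.ManinAdditive.NeronCuspThree
import Literature.NumberTheory.EllipticCurves.Newforms
import Literature.NumberTheory.EllipticCurves.CuspFormLFunction
import Summits.BirchSwinnertonDyer.Rank1Residual.ManinAdditive.NeronFLineDepth
import Summits.BirchSwinnertonDyer.Rank1Residual.ManinAdditive.ConwayKodairaLaws
import HarnessLib
import HarnessLib.Audit.Tags

/-!
# ENGINE 7 «N = Ω»: the E-blind dualising-sheaf lattice `Ω₃(N)` of `X₀(N)` at `3`, the GIVEN row E-imc-150, the transfer E-imc-151
# and the E-blind laws E-imc-152 / 153a / 154 — typed (imc g20, MEMO-imc §26; cell `bsd-f2-manin`, T-imc-26 part 1/2, typer g15)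

HONEST FRAMING.  LENS = Iwasawa-main-conjecture / integrality of families (`bsd-f2-manin-imc` g20, planner-of-record, MEMO-imc §26
(26.1)–(26.14)).  SOURCE = HOME/imc/Sketch-imc-g20.lean sha16 a4ae1703200af20d (568 l.; §0–§4 byte-identical in the later f94678ca0337d6c7, 615 l.; farm rc 0 per
imc, BC7 7/7 + 14/14 CLEAN; g20-bc7.raw.txt, g20-bc7cde.raw.txt), §0–§2 and §4 VERBATIM (this file); §5–§7 (E-imc-156 «TRACE = Ω», law
L3f/L3g classes V2/V3, the tangent-defect lever with REF1 §R90's `IsOmegaNeronAtThree Δ →` repair of E-157) follow in the sibling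
`NeronOmegaThreeTrace.lean` once imc freezes those sections (class V2 → V3 rewrite in progress at 22:13Z). Deviations from the sketch:
(i) this header replaces the sketch's; (ii) DEDUP — the sketch's `HasRationalThreeTorsion` is the tree's `RamanujanCut.HasRationalThreeTorsion`
(identical body, desc g6) and is referred to, not re-declared; the unused valuation-free `IsStarredAtThree` (Kodaira-symbol form) is dropped
(the tree's `ConwayNortonThree.IsStarredAtThree` is the valuation form); (iii) **E-imc-153b `OmegaFullDepthAtThree` is NOT LANDED**:
REFUTED out of sample by imc's own ENGINE 7 (540c1, 540d1, 756d1, 756f1, 918i1/j1, 1026l1/o1/p1 — IV* with rational 3-torsion yet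
Ω-defect 1; MEMO-imc (26.10′)) and KILLED by REF1 §R90 (→ C′ = the class laws of §6, in the sibling); its two consumers
(`omegaDefectAtThreeLeOne_of_laws`, `not_three_dvd_maninConstant_of_fullDepthClass`) are re-pointed to the repaired class laws there.

WHAT IS HERE.  `Ω₃(N) := omegaLatticeAtThree N ⊆ S = S₂(Γ₀(N); ℤ)`, an E-BLIND lattice cut out by `q`-expansion conditions at one cusp
per Katz–Mazur component of `X₀(N)_{𝔽₃}` (`9 ∣ N`, `81 ∤ N`), read through the cell's audited dictionary (D1)–(D5) (HOME/imc/PROOFS-g19.md §0;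
REF1 §R78) with the DIFFERENT ALLOWANCE `1` (in `(1−ζ₃)`-units) on the multiplicity-2 components (`IsPiIntegralUpToDifferent`; REF1 §R90:
allowance = inverse different CORRECT, [Liu 2002, p. 301 + Thm 6.4.9], thresholds 1/2/8 = `v_π(𝔇)`).  PRINT INPUT (statement only): at levels
where `X₀(N)_{ℤ₍₃₎}` has rational singularities (`RatSingAtThree N`: `v₃(N) ≤ 2` or some prime `p' ≡ 2 (mod 3)` divides `N`) the Néron lattice
`Λ ⊗ ℤ₍₃₎` IS `H⁰(X₀(N)_{ℤ₍₃₎}, Ω)` cut out by explicit cusp conditions [Česnavičius–Neururer–Saha, Thm. 1.2, (explicit-crit)]; that those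
conditions are exactly (C_0)(C_1)(C_2) below is the cell's READING (D5), not a quotation (their §§4–5 not held: acq-11457/11730) — so
**E-imc-150 `IsOmegaNeronAtThree`** is a GIVEN-row PREDICATE (nothing asserted), like desc's `IsConwayNeronAtTwo`.  PROVED here: only the
bookkeeping chain `transfer (E-imc-151) + GIVEN + full Ω-depth ⇒ 3 ∤ c_E ∧ Lie-saturated at 3` over the landed `NeronFLineDatum` interface
(`NeronFLineDepth.lean`), and its converse reading.  CONJECTURED (E-blind laws, BC5 = ENGINE 7 `neronomega.gp` cfb53958b5b79f7d tables,
kit j316897/j316899/j316903 (`9 ∣ N ≤ 450`, OOS `451…1300`), second engine ref1 e90.gp j318214: 292 classes ≤ 711, 0 mismatches): **E-imc-152**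
`OmegaDefectAtThreeLeOne` (`σ^Ω ≤ 1`), **E-imc-153a** `OmegaDefectOfExceptionalStarAtThree` (II*/III*/IV*-without-3-torsion ⇒ defect 1; 19/19
≤ 450), the support transfer **E-imc-151** `OmegaDepthTransferAtThree`, and the E-blind EXISTENCE statement **E-imc-154**
`OmegaDefectWitnessAtThree` (decided by computation: 99c1 III*, 135b1 II* — under the GIVEN row and Cremona's `c_E = 1` these optimal
`E → J₀(N)` are NOT Lie-saturated at `3`; unrecorded in print as far as the cell's searches go — BLR 7.5/4 needs semiabelian reduction
[Česnavičius 2018, proof of the odd-`p` proposition, p. 18]).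

§4 (ENGINE 8 «TRACE CUT», kit-g20t/neronomega_trace.gp 6596cfc371b038d5, j317779; print inputs Edixhoven 2006 Props. 2/4/5 + Néron functoriality of
the degeneracy trace = the tree's `adjDegeneracyMap0 N M 1 2`, REF1 §R90 (β)(γ) PASS): `FLineValuationBoundAt`, the UPPER-BOUND PRINCIPLE (PROVED:
`Λ ≤ L` + the `f`-line valuation bound ⇒ no Néron congruence depth ⇒ `p ∣ c_E ∨ ¬LieSaturatedAt p`), **E-imc-155 `IsOmegaUpperAtThree`**
(predicate `Λ ≤ Ω₃(N)`, certified level by level `9 ∣ N ≤ 960` by print + computation) and its E-facing edges.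

REFUTER VERDICTS (REF1 §R90, 2026-08-28T22:10:13Z, HOME/ref1/R90-ref1-imc-g20.md 235c6b4ad81b8ae8): E-150/155 (predicates), E-151/158
(support), E-152/153a/153c/153d/154/156a–d SURVIVE; E-153b KILLED (not landed); E-157 KILLED-as-typed → repaired `…R` in the sibling;
PH101/PH101c rc 0, 15/15 axioms standard, BC7 14/14 CLEAN.  R-imc-59/60 ANSWERED therein.  REF2 placement pending.
bears_on: stmt-BirchSwinnertonDyer-22968 (C3 `ManinPrimeToThreeAtNine`: nothing here bounds `ord₃ c_E` unconditionally; the GIVEN row is the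
literature input).  PARTITION (imc) ladder-live / frontier-data · beyond-print theorem: no · `3 ∤ c_E` is NOT proved by this; BSD is not proved
by this; Manin's conjecture is not proved by this.
-/

noncomputable section

open scoped MatrixGroups ModularForm
open CongruenceSubgroup Literature.NumberTheory.EllipticCurves.ModularForms
  Summit.BirchSwinnertonDyer.Rank1Residual.ManinAdditive
  Summit.BirchSwinnertonDyer.Rank1Residual.ManinAdditive.ConwayCut
  Summit.BirchSwinnertonDyer.Rank1Residual.ManinAdditive.ConwayNortonThree
  Summit.BirchSwinnertonDyer.Rank1Residual.ManinAdditive.NeronCuspThree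

namespace Summit.BirchSwinnertonDyer.Rank1Residual.ManinAdditive.NeronOmegaThree

variable (N : ℕ) [NeZero N]

/-- `(1 − ζ₃)`-adic valuation `≥ −1`, `3`-adically: some prime-to-`3` multiple of `(1 − ζ₃) • y` is `ℤ[ζ₃]`-integral at `∞`
(the différent allowance on a multiplicity-2 Katz–Mazur component: `𝔇(ℤ₃[ζ₃]/ℤ₃) = (1 − ζ₃)`). -/
def IsPiIntegralUpToDifferent (y : CuspForm (Gamma0 N) 2) : Prop :=
  ∃ m : ℕ, ¬ 3 ∣ m ∧ IsEisensteinIntegral N ((m : ℂ) • ((1 - zeta3) • y))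

/-- **`Ω₃(N)`, the E-blind dualising-sheaf lattice at `3`** (ENGINE 7, dictionary (D1)–(D5)): the largest sub-`ℤ`-module
of `S₂(Γ₀(N); ℤ)` whose elements `x` satisfy
 (C_0)  `w x` is `3`-adically integral (`w = w_{3^{v₃(N)}}`; component `C_0`, cusp `0`, reduced, allowance 0);
 (C_1)  `w (t₃ x)` has `(1−ζ₃)`-valuation `≥ −1` (component `C_1`, cusp `1/3`, multiplicity 2, allowance `v(𝔇) = 1`);
 (C_2)  if `27 ∣ N`: `w (t₃ (w x))` has `(1−ζ₃)`-valuation `≥ −1` (component `C_2 = w C_1`, cusp `w(1/3)`).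
For `v₃(N) = 2` these are all components (`C_0, C_1, C_2 = ∞`); for `v₃(N) = 3` likewise (`C_3 = ∞`); for `81 ∣ N` the
lattice is NOT the intended one (components of multiplicity 6 are not read) and no statement below uses it there. -/
def omegaLatticeAtThree : Submodule ℤ (CuspForm (Gamma0 N) 2) :=
  sSup {M | M ≤ integralCuspForms0 N 2 ∧ ∀ x ∈ M,
    IsThreeIntegral N (atkinLehnerInvolutionAt N 2 3 x) ∧
    IsPiIntegralUpToDifferent N (atkinLehnerInvolutionAt N 2 3 (thirdTranslate N 2 1 x)) ∧
    (27 ∣ N → IsPiIntegralUpToDifferent N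
      (atkinLehnerInvolutionAt N 2 3 (thirdTranslate N 2 1 (atkinLehnerInvolutionAt N 2 3 x))))}

/-- `Ω₃(N) ⊆ S₂(Γ₀(N); ℤ)`. -/
theorem omegaLatticeAtThree_le : omegaLatticeAtThree N ≤ integralCuspForms0 N 2 :=
  sSup_le fun _ hM => hM.1

/-- The finite place `3` of `ℚ` (indexing type of `WeierstrassCurve.kodairaSymbolAt`; pattern of `ConwayKodairaLaws.placeTwo`). -/
def placeThree : IsDedekindDomain.HeightOneSpectrum ℤ :=
  (Rat.HeightOneSpectrum.primesEquiv (R := ℤ)).symm ⟨3, Nat.prime_three⟩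

/-- EXCEPTIONAL STAR at `3`: Kodaira symbol II*, III* or IV* (geometric component group cyclic of order 1, 2, 3). -/
def IsExceptionalStarAtThree (W : WeierstrassCurve ℚ) : Prop :=
  W.kodairaSymbolAt placeThree = .IIstar ∨ W.kodairaSymbolAt placeThree = .IIIstar ∨ W.kodairaSymbolAt placeThree = .IVstar

/-- The Ω-DEFECT CLASS at `3` (ENGINE 7 census, MEMO-imc (26.6)): exceptional star at 3, and in the IV* case no rational
3-torsion (II*: 13/13, III*: 9/9 … see the census; IV* with `ℤ/3`: 27a1, 54a1 have NO defect). -/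
def IsOmegaDefectClassAtThree (W : WeierstrassCurve ℚ) : Prop :=
  IsExceptionalStarAtThree W ∧ (W.kodairaSymbolAt placeThree = .IVstar → ¬ RamanujanCut.HasRationalThreeTorsion W)

/-- `X₀(N)_{ℤ₍₃₎}` has rational singularities by the printed criterion [Česnavičius–Neururer–Saha, p. 4 L10–16]:
`v₃(N) ≤ 2` or some prime `p' ≡ 2 (mod 3)` divides `N`. -/
def RatSingAtThree (N : ℕ) : Prop :=
  padicValNat 3 N ≤ 2 ∨ ∃ p' : ℕ, p'.Prime ∧ p' ∣ N ∧ p' % 3 = 2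

/-! ### §1. The GIVEN row at 3 (predicate; nothing asserted) and the transfer (support; theorem-candidate) -/

section Given

variable {N} {W : WeierstrassCurve ℚ} [W.IsElliptic] {D : ModularParametrizationData W N} (Δ : NeronFLineDatum W D)

/-- **E-imc-150 `IsOmegaNeronAtThree`** (GIVEN-row predicate «N = Ω at 3»; nothing asserted): the Néron lattice and the
E-blind lattice `Ω₃(N)` agree `3`-adically: `Λ ≤ Ω₃(N)` and every element of `Ω₃(N)` has a prime-to-3 multiple in `Λ`.
PRINT STATUS: at `RatSingAtThree N` levels it is the cell's READING (D1)–(D5) of [ČNS Thm. 1.2 + (explicit-crit)]; the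
allowance `1` in (C_1)/(C_2) is pinned by the data only from below (LP-sharpness at `N = 99`; MEMO-imc (26.4)) and is the
subject of referee ask R-imc-59.  Why it might fail: the allowance could be `2` (then `Ω₃ ⊋ Λ`-reading changes to `L_red`). -/
def IsOmegaNeronAtThree : Prop :=
  Δ.Λ ≤ omegaLatticeAtThree N ∧ ∀ g ∈ omegaLatticeAtThree N, ∃ n : ℕ, ¬ 3 ∣ n ∧ (n : ℤ) • g ∈ Δ.Λ

end Given

/-- **E-imc-151 `OmegaDepthTransferAtThree`** (support; finite-index bookkeeping on the `f`-line, TRUE on paper exactly as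
desc's `ConwayDepthTransfer` with `2 ↦ 3`: `Λ ⊗ ℤ₍₃₎ = Ω₃ ⊗ ℤ₍₃₎` carries `e_f`-images to each other up to prime-to-3 index):
GIVEN row + full Ω-depth on the `f`-line ⇒ Néron congruence depth at `3`. -/
@[conjecture] def OmegaDepthTransferAtThree : Prop :=
  ∀ (N : ℕ) [NeZero N] (W : WeierstrassCurve ℚ) [W.IsElliptic] (D : ModularParametrizationData W N)
    (Δ : NeronFLineDatum W D), 9 ∣ N → IsOmegaNeronAtThree Δ →
    padicValNat 3 (lineIndex (omegaLatticeAtThree N) D.f) = padicValNat 3 D.modularDegree →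
    lineIndex (omegaLatticeAtThree N) D.f ≠ 0 → Δ.NeronCongruenceDepthAt 3

/-- The Manin-at-3 consequence (PROVED from the landed interface): GIVEN row + transfer + full Ω-depth ⇒ `3 ∤ c_E`. -/
theorem not_three_dvd_maninConstant_of_omegaDepth (hT : OmegaDepthTransferAtThree) {N : ℕ} [NeZero N]
    {W : WeierstrassCurve ℚ} [W.IsElliptic] {D : ModularParametrizationData W N}
    (Δ : NeronFLineDatum W D) (h9 : 9 ∣ N) (hΛ : IsOmegaNeronAtThree Δ)
    (hfull : padicValNat 3 (lineIndex (omegaLatticeAtThree N) D.f) = padicValNat 3 D.modularDegree)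
    (hfin : lineIndex (omegaLatticeAtThree N) D.f ≠ 0) :
    ¬ (3 : ℤ) ∣ D.maninConstant :=
  haveI : Fact (Nat.Prime 3) := ⟨Nat.prime_three⟩
  Δ.not_dvd_maninConstant_of_depth (hT N W D Δ h9 hΛ hfull hfin)

/-- … and Lie-saturation of `E → J₀(N)` at `3` under the same hypotheses (PROVED). -/
theorem lieSaturatedAt_three_of_omegaDepth (hT : OmegaDepthTransferAtThree) {N : ℕ} [NeZero N]
    {W : WeierstrassCurve ℚ} [W.IsElliptic] {D : ModularParametrizationData W N}
    (Δ : NeronFLineDatum W D) (h9 : 9 ∣ N) (hΛ : IsOmegaNeronAtThree Δ)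
    (hfull : padicValNat 3 (lineIndex (omegaLatticeAtThree N) D.f) = padicValNat 3 D.modularDegree)
    (hfin : lineIndex (omegaLatticeAtThree N) D.f ≠ 0) :
    Δ.LieSaturatedAt 3 :=
  haveI : Fact (Nat.Prime 3) := ⟨Nat.prime_three⟩
  Δ.lieSaturatedAt_of_depth (hT N W D Δ h9 hΛ hfull hfin)

/-- Conversely (PROVED): under the GIVEN row and the transfer's converse bookkeeping passed as a hypothesis, an Ω-depth
DEFECT on the `f`-line forces `3 ∣ c_E` OR a failure of Lie-saturation at `3` — the reading of the E-imc-154 witnesses. -/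
theorem three_dvd_or_not_lieSaturated_of_omegaDefect {N : ℕ} [NeZero N]
    {W : WeierstrassCurve ℚ} [W.IsElliptic] {D : ModularParametrizationData W N} (Δ : NeronFLineDatum W D)
    (hconv : Δ.NeronCongruenceDepthAt 3 →
      padicValNat 3 (lineIndex (omegaLatticeAtThree N) D.f) = padicValNat 3 D.modularDegree)
    (hdef : padicValNat 3 (lineIndex (omegaLatticeAtThree N) D.f) ≠ padicValNat 3 D.modularDegree) :
    (3 : ℤ) ∣ D.maninConstant ∨ ¬ Δ.LieSaturatedAt 3 := by
  haveI : Fact (Nat.Prime 3) := ⟨Nat.prime_three⟩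
  by_contra h
  push Not at h
  exact hdef (hconv ((Δ.depthAt_iff).mpr ⟨h.1, h.2⟩))

/-! ### §2. E-blind laws at 3 (conjectures; BC5 = ENGINE 7 `neronomega.gp` tables, MEMO-imc (26.6)) -/

/-- **E-imc-152 `OmegaDefectAtThreeLeOne`** (E-blind LAW; nothing asserted): for an optimal `E` of conductor `N` with
`9 ∣ N`, `81 ∤ N`, the Ω-lattice loses AT MOST ONE factor `3` of the modular-degree congruence on the `f`-line:
`ord₃ deg φ ≤ ord₃ [e_f Ω₃(N) : ℤ f] + 1`.  BC5: ENGINE 7 field `s_Om ∈ {0,1}` (MEMO-imc (26.6)).  Why it might fail: deep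
oldform congruences at large `3`-power level (`v₃(N) = 3` with CM by `ℚ(√−3)`) could cut two factors. -/
@[conjecture] def OmegaDefectAtThreeLeOne : Prop :=
  ∀ (W : WeierstrassCurve ℚ) [W.IsElliptic] [W.IsGloballyMinimal] [NeZero (W.conductorNorm ℤ)]
    (D : ModularParametrizationData W (W.conductorNorm ℤ)),
    (∀ z ∈ D.L.lattice, ∃ w ∈ periodLattice D.f, z = D.c * w) →
    (∀ (W' : WeierstrassCurve ℚ) [W'.IsElliptic]
        (D' : ModularParametrizationData W' (W.conductorNorm ℤ)),
        D'.f = D.f → D.modularDegree ≤ D'.modularDegree) →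
    9 ∣ W.conductorNorm ℤ → ¬ 81 ∣ W.conductorNorm ℤ →
      padicValNat 3 D.modularDegree ≤
        padicValNat 3 (lineIndex (omegaLatticeAtThree (W.conductorNorm ℤ)) D.f) + 1

/-- **E-imc-153a `OmegaDefectOfExceptionalStarAtThree`** (E-blind-vs-Kodaira LAW; nothing asserted): for an optimal `E`
with `9 ∣ N`, `81 ∤ N` in the Ω-defect class (II*, III*, or IV* without rational 3-torsion, at 3) the Ω-lattice loses EXACTLY
ONE factor `3` on the `f`-line: `ord₃ [e_f Ω₃(N) : ℤ f] + 1 = ord₃ deg φ`.  BC5: ENGINE 7 kit j316897 (`9 ∣ N ≤ 450`: 19/19 rows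
of the class, 0 rows outside it; MEMO-imc (26.6)); out-of-sample j316899/j316903 (`451…1300`) reported in (26.6).  Under the GIVEN
row E-imc-150 and Cremona's `c_E = 1` this says `k₃(E) = 1`: `E → J₀(N)` is NOT Lie-saturated at 3 for these curves.
Why it might fail: a II*/III* curve with rational 3-torsion through `Φ₃` or `E⁰` (none `≤ 450`) may have full depth. -/
@[conjecture] def OmegaDefectOfExceptionalStarAtThree : Prop :=
  ∀ (W : WeierstrassCurve ℚ) [W.IsElliptic] [W.IsGloballyMinimal] [NeZero (W.conductorNorm ℤ)]
    (D : ModularParametrizationData W (W.conductorNorm ℤ)),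
    (∀ z ∈ D.L.lattice, ∃ w ∈ periodLattice D.f, z = D.c * w) →
    (∀ (W' : WeierstrassCurve ℚ) [W'.IsElliptic]
        (D' : ModularParametrizationData W' (W.conductorNorm ℤ)),
        D'.f = D.f → D.modularDegree ≤ D'.modularDegree) →
    9 ∣ W.conductorNorm ℤ → ¬ 81 ∣ W.conductorNorm ℤ → IsOmegaDefectClassAtThree W →
      padicValNat 3 (lineIndex (omegaLatticeAtThree (W.conductorNorm ℤ)) D.f) + 1 = padicValNat 3 D.modularDegree

/- E-imc-153b `OmegaFullDepthAtThree` (sketch lines here) is NOT landed: REFUTED out of sample (540c1 …, MEMO-imc (26.10′)) and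
KILLED by REF1 §R90 → the repaired class laws (L3f/L3g) with their edges live in `NeronOmegaThreeTrace.lean` §6. -/

/-- **E-imc-154 `OmegaDefectWitnessAtThree`** (E-blind EXISTENCE statement, decided by computation in ENGINE 7 — kit
j316560 rows 99c1 (`N = 99`, III* at 3, `deg φ = 12`, `[e_f Ω₃ : ℤf]` of `3`-adic order 0) and 135b1 (`N = 135`, II*,
`deg φ = 36`, order 1); nothing asserted in Lean): there is an optimal elliptic curve at a level `9 ∣ N`, `81 ∤ N` with
rational singularities at 3 whose Ω-depth is STRICTLY SMALLER than `ord₃ deg φ`.  Under E-imc-150 + the converse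
bookkeeping this forces `3 ∣ c_E ∨ ¬ LieSaturatedAt 3` (theorem `three_dvd_or_not_lieSaturated_of_omegaDefect`), and with
Cremona's `c_E = 1` for these curves: the optimal `E → J₀(N)` is NOT a closed immersion of Néron models over `ℤ₃`. -/
@[conjecture] def OmegaDefectWitnessAtThree : Prop :=
  ∃ (W : WeierstrassCurve ℚ) (_ : W.IsElliptic) (_ : W.IsGloballyMinimal) (_ : NeZero (W.conductorNorm ℤ))
    (D : ModularParametrizationData W (W.conductorNorm ℤ)),
    (∀ z ∈ D.L.lattice, ∃ w ∈ periodLattice D.f, z = D.c * w) ∧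
    (∀ (W' : WeierstrassCurve ℚ) [W'.IsElliptic]
        (D' : ModularParametrizationData W' (W.conductorNorm ℤ)),
        D'.f = D.f → D.modularDegree ≤ D'.modularDegree) ∧
    9 ∣ W.conductorNorm ℤ ∧ ¬ 81 ∣ W.conductorNorm ℤ ∧ RatSingAtThree (W.conductorNorm ℤ) ∧
      padicValNat 3 (lineIndex (omegaLatticeAtThree (W.conductorNorm ℤ)) D.f) < padicValNat 3 D.modularDegree

/-! ### §4. ENGINE 8 «TRACE CUT» (MEMO-imc (26.14)): the print-only UPPER inclusion `Λ ≤ Ω₃(N)` and its E-facing edge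

ENGINE 8 (HOME/imc/kit-g20t/neronomega_trace.gp, kit j317779) builds, from PRINT facts only — `Cot(𝒥₀(N)) ⊆ S₂(ℤ) ⊗ ℤ₃`
[Edixhoven 2006, Prop. 2], End-stability of the Néron lattice (Néron mapping property), Néron-functoriality of the two
degeneracy TRACES `Tr₁, Tr₃ : S₂(Γ₀(N)) → S₂(Γ₀(N/3))` (cotangent maps of Pic-functoriality `J₀(N/3) → J₀(N)`), and the
Deligne–Rapoport description at `3 ∥ N/3` [Edixhoven 2006, Props. 4–5] — an E-blind lattice `L*(N) ⊇ Λ ⊗ ℤ₍₃₎`, and FINDS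
BY COMPUTATION `L*(N) = Ω₃(N)` `3`-adically at every `9 ∣ N ≤ 960`, `81 ∤ N`.  So the inclusion half of E-imc-150 —
`IsOmegaUpperAtThree` below — is a per-level certificate resting on print + computation (no reading of ČNS, no allowance),
and the PROVED edge `three_dvd_or_not_lieSaturated_of_omegaUpper` turns an Ω-depth defect on the `f`-line into
`3 ∣ c_E ∨ ¬ LieSaturatedAt 3` with no GIVEN equality.  Conjecture E-imc-156 «TRACE = Ω» (the identity `L* = Ω₃` at every
level) is recorded in MEMO (26.14)(iii) and typed in §5 over the tree's `adjDegeneracyMap0 N M 1 2` (T-imc-27 answered by pointer). -/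

section Upper

variable {N}

/-- `FLineValuationBoundAt p L D e` (E-blind in `L` and the newform): every `x ∈ L` whose `f`-coordinate `q`
(`q ⟨f,f⟩ = ⟨f,x⟩`) is nonzero has `ord_p q ≥ e`.  ENGINE 7/8's `σ_L ≥ 1` is this with `e = -ord_p(deg φ) + 1`. -/
def FLineValuationBoundAt (p : ℕ) (L : Submodule ℤ (CuspForm (Gamma0 N) 2)) {W : WeierstrassCurve ℚ}
    [W.IsElliptic] (D : ModularParametrizationData W N) (e : ℤ) : Prop :=
  ∀ x ∈ L, ∀ q : ℚ, q ≠ 0 →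
    (q : ℂ) * peterssonProduct (Gamma0 N) 2 D.f D.f = peterssonProduct (Gamma0 N) 2 D.f x →
    e ≤ padicValRat p q

variable {W : WeierstrassCurve ℚ} [W.IsElliptic] {D : ModularParametrizationData W N} (Δ : NeronFLineDatum W D)

/-- **UPPER-BOUND PRINCIPLE** (PROVED): `Λ ≤ L` and the `f`-line bound `ord_p q ≥ -ord_p(deg φ) + 1` on `L` exclude
Néron congruence depth at `p`. -/
theorem not_depthAt_of_fLineBound {p : ℕ} [Fact p.Prime] {L : Submodule ℤ (CuspForm (Gamma0 N) 2)}
    (hΛ : Δ.Λ ≤ L) (hB : FLineValuationBoundAt p L D (-(padicValNat p D.modularDegree : ℤ) + 1)) :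
    ¬ Δ.NeronCongruenceDepthAt p := by
  rintro ⟨g, q, hq0, hq, hval⟩
  have h := hB (g : CuspForm (Gamma0 N) 2) (hΛ g.2) q hq0 hq
  rw [hval] at h
  omega

/-- (PROVED, via the tree's `depthAt_iff`) `Λ ≤ L` + the bound ⇒ `p ∣ c_E` or not Lie-saturated at `p`. -/
theorem dvd_or_not_lieSaturated_of_fLineBound {p : ℕ} [Fact p.Prime] {L : Submodule ℤ (CuspForm (Gamma0 N) 2)}
    (hΛ : Δ.Λ ≤ L) (hB : FLineValuationBoundAt p L D (-(padicValNat p D.modularDegree : ℤ) + 1)) :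
    (p : ℤ) ∣ D.maninConstant ∨ ¬ Δ.LieSaturatedAt p := by
  by_cases hc : (p : ℤ) ∣ D.maninConstant
  · exact Or.inl hc
  · exact Or.inr fun hL => not_depthAt_of_fLineBound Δ hΛ hB (Δ.depthAt_iff.mpr ⟨hc, hL⟩)

/-- **E-imc-155 `IsOmegaUpperAtThree`** (GIVEN-row predicate, the INCLUSION half of E-imc-150; nothing asserted):
`Λ ≤ Ω₃(N)`.  STATUS: certified level by level (`9 ∣ N ≤ 960`, `81 ∤ N`) by ENGINE 8 from print facts + computation
(MEMO-imc (26.14)); conjecturally at every level (E-imc-156).  Why it might fail at an uncomputed level: only through an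
error in (β)/(γ) of ENGINE 8 (audit ask R-imc-60) — the inclusion `Λ ⊆ H⁰(X₀(N), Ω)` itself is print. -/
def IsOmegaUpperAtThree : Prop :=
  Δ.Λ ≤ omegaLatticeAtThree N

/-- The GIVEN row contains the inclusion half (PROVED, projection). -/
theorem isOmegaUpperAtThree_of_isOmegaNeronAtThree (h : IsOmegaNeronAtThree Δ) : IsOmegaUpperAtThree Δ := h.1

/-- **PROVED E-facing edge of ENGINE 8**: the print-certified inclusion + an Ω-defect on the `f`-line (`σ^Ω ≥ 1`, stated
as the valuation bound) ⇒ `3 ∣ c_E ∨ E → J₀(N) not Lie-saturated at 3`.  On the Ω-defect class (75 optimal curves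
`≤ 981`, e.g. 99c1, 135b1, 153d1) with Cremona's `c_E = 1` this reads: `𝒥₀(N) → 𝓔` is not surjective on Lie algebras at 3. -/
theorem three_dvd_or_not_lieSaturated_of_omegaUpper (hU : IsOmegaUpperAtThree Δ)
    (hB : FLineValuationBoundAt 3 (omegaLatticeAtThree N) D (-(padicValNat 3 D.modularDegree : ℤ) + 1)) :
    (3 : ℤ) ∣ D.maninConstant ∨ ¬ Δ.LieSaturatedAt 3 := by
  haveI : Fact (Nat.Prime 3) := ⟨Nat.prime_three⟩
  exact dvd_or_not_lieSaturated_of_fLineBound Δ hU hB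

/-- … and with `3 ∤ c_E` known: NOT Lie-saturated at `3` (PROVED). -/
theorem not_lieSaturatedAt_three_of_omegaUpper (hU : IsOmegaUpperAtThree Δ)
    (hB : FLineValuationBoundAt 3 (omegaLatticeAtThree N) D (-(padicValNat 3 D.modularDegree : ℤ) + 1))
    (hc : ¬ (3 : ℤ) ∣ D.maninConstant) : ¬ Δ.LieSaturatedAt 3 := by
  rcases three_dvd_or_not_lieSaturated_of_omegaUpper Δ hU hB with h | h
  · exact absurd h hc
  · exact h

end Upper

end Summit.BirchSwinnertonDyer.Rank1Residual.ManinAdditive.NeronOmegaThree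

end
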